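import Summits.QuantumFields.YangMills.Theorems.BalabanUVNodesN15TwoSpacingGluingNeumannRemainderDefect
import Summits.QuantumFields.YangMills.Theorems.BalabanUVNodesN15TwoSpacingGluingNeumannKnitRecord
import HarnessLib

/-!
# THE GLUING STEP AT TWO LATTICE SPACINGS, XXXVII: THE TWO-GRID η-DEFECT OF THE REMAINDER ROW OF ONE LIFTED NEUMANN CUBE OF THE COVER ON THE TORUS OF RECORD — EVERY ROW OF
# FILES 74–76 INHABITED BY dag-n15-a's PROGRAMME P (P-IIb, P-IIc, P-IId, P-IIe, the Landau defect), RATE `(L^K)^{−1∕16}`, THE ONE IMAGES-TYPE ROW DISPLAYED, CONSTANTS UNIFORM IN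
# THE VOLUME (dag-n15-c g12, FILE 79; N15 = NE2, s1 «background-layer OPERATOR ingredient»)

Cell `pub-ymgap`, seat `pub-ymgap-dag-n15-c` (R134 (a); HUMAN RULING D-0062), generation 12.  `bears_on: R4∕N15 · K3⁷ SpineGivenEndpointR13SepCoPH (stmt-QuantumFields-20544)`.
Filed `--supports stmt-QuantumFields-20544 --as helper` — COUNT-NEUTRAL.  Theorems only (0 `def`, 0 `sorry`).  Imports BY NAME FILE 77 (`remainderDefectConst_le`, `rB_le_of`, `r3_le_of`,
`rpow_sixteenth_facts`; through it FILES 69, 74–76), FILE 73 (`knitHR`, `knitGR`, `MP_eq_two_mul`; through it dag-n15-a P-IIb∕P-IIc∕P-IId∕P-IIe), `hasMaj_landauDefect_family`; nothing in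
the tree is modified.

WHAT.  On the torus of record `M = MP (paramsOf d L m_T K hL)` (volume `2L^{m_T}` FREE), cover cube `□_k` of side `L^{s+1}` (FILE 73 `knitGR` = dag-n15-a `liftCubeG`), partition `h_k`
(FILE 73 `knitHR`), coarse spacing `L^{−K}`, fine spacing `L^{−(K+r)}`, King's pairing `P`:
* §1 ★ `restrictOp_comp_mulOp_chiCube`, ★ `liftCubeG_comp_mulOp_chiCube` (the lift does not see a source cut by `χ_□` on the big torus: FILE 76's `hNχ`);
* §2 ★★★ **`hasMaj_idef_commOp_deltaOp_comp_knitGR`**: GIVEN the images-type row `HY` (the torus-of-record lift of dag-n15-c WANT g12-4), there are `δ, C_r > 0` — free of the VOLUME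
  `m_T`, the cube exponent `s`, the spacings `K, r` and the cube index — with `𝔇([Δ′_a, M_{h′_k}]G′^{↑}(□_k), [Δ_a, M_{h_k}]G^{↑}(□_k)) ≤ 1_□(y′)·C_r(L^K)^{−1∕16}·e^{−δ|y−y′|_T}` for
  `s + 1 ≤ m_T`, `K ≥ 1`, `4 ≤ L^K`: FILE 74 with the rows of P-IIb (`hasMaj_chiCube_liftCubeG`, `hasMaj_chiCube_grad_liftCubeG`), P-IId (`hasMaj_chiCube_divAdjOut_liftCubeG_pair`,
  `hasMaj_idef_chiCube_divAdjOut_liftCubeG`), P-IIc (`hasMaj_idef_chiCube_liftCubeG`, `hasMaj_idef_chiCube_grad_liftCubeG`), P-IIe (`hasMaj_chiCube_comp_liftCubeG_family`), FILE 69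
  (`hasMaj_nonlocalPart`), FILE 75 §§1–2, FILE 76, `hasMaj_landauDefect_family`, compressed by FILE 77 `remainderDefectConst_le`.

HONEST FRAMING ∕ LIMITS.  Block-majorant bookkeeping over LANDED rows at `U ≡ 1` (cube letters from dag-n15-a's doubled-cube tori, uniform in the volume); the two-grid DIFFERENCE TEMPLATE
of [B9] Thm 3.14 pp.426–427 applied to [B6] §2's remainder row (2.92)–(2.93) p.239, (2.133)–(2.136) p.247 at the level of SHAPES; the one displayed row `HY` is dag-n15-a's pen.  Nothing of
[B5]∕[B6]∕[B9] asserted.  NE2⁺ NOT PRINTED, NOT proved; N15 NOT discharged; counts of record UNMOVED (typed 28∕28 · discharged 5∕27); one finite 𝕋⁴ at fixed ε per index — NOT infinite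
volume, NOT OS on ℝ⁴, NOT a mass gap, NOT Clay; R4 closes the conditional finite-𝕋⁴ rung `BalabanLadder.UV` only.  Restate-immune.
-/

noncomputable section

namespace Summit.QuantumFields.YangMills.BalabanUVNodes.N15.Gluing

open Real
open Literature.MathematicalPhysics.QuantumFieldTheory.Balaban1983to89
open Literature.MathematicalPhysics.QuantumFieldTheory.Balaban1983to89.B5Prop11Plancherel (Tor fine)
open Literature.MathematicalPhysics.QuantumFieldTheory.Balaban1983to89.B11SectG (BlockNorm HasMaj RowSum)
open Literature.MathematicalPhysics.QuantumFieldTheory.Balaban1983to89.T4EtaRateDefect (idef)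
open Literature.MathematicalPhysics.QuantumFieldTheory.Balaban1983to89.T4EtaRateCoeffDefect (pull)
open Literature.MathematicalPhysics.QuantumFieldTheory.Balaban1983to89.B6Prop26Gluing (mulOp mulOp_apply ind ind_nonneg ind_le_one)
open Literature.MathematicalPhysics.QuantumFieldTheory.Balaban1983to89.B6Prop26ReachTransplant (restrictOp restrictOp_apply)
open Literature.MathematicalPhysics.QuantumFieldTheory.Balaban1983to89.B6UnitTorusCarrier (unitTorusGeo triangle254_unitTorusGeo rowSum_unitTorusGeo unitTorusGeo_dist_nonneg)
open Literature.MathematicalPhysics.QuantumFieldTheory.Balaban1983to89.B5SiteBridgeP12 (MP)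
open Literature.MathematicalPhysics.QuantumFieldTheory.King1986.Torus (blockOf tdistT tdistT_nonneg)
open Summit.QuantumFields.YangMills.BalabanUVNodes.N15.VectorPiece (bshiftEquiv kingPrV blkFine)
open Summit.QuantumFields.YangMills.BalabanUVNodes.N15.BackgroundLayer (fgrad bgrad symbOp_sD_eq)
open Summit.QuantumFields.YangMills.BalabanUVNodes.N15.TwoGrid (symbOp sD sTinv paramsOf deltaOp gOp neumannCubeG chiCube cubeBlocks cubeW chiCube_eq_ite liftCubeG MP_dvd_MP redBond
  torRed landauRe qvRe qvAdjRe hasMaj_landauRe hasMaj_chiCube_liftCubeG hasMaj_chiCube_grad_liftCubeG hasMaj_chiCube_divAdjOut_liftCubeG_pair hasMaj_idef_chiCube_liftCubeG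
  hasMaj_idef_chiCube_grad_liftCubeG hasMaj_idef_chiCube_divAdjOut_liftCubeG hasMaj_chiCube_comp_liftCubeG_family hasMaj_landauDefect_family)

variable {d : ℕ}

/-! ## §1 The lift does not see a source cut by `χ_□` -/

section Cut

variable {M M' : Fin (d + 1) → ℕ} [∀ μ, NeZero (M μ)] [∀ μ, NeZero (M' μ)] (n : ℕ) [NeZero n] (hM : ∀ μ, M' μ ∣ M μ) (c : Tor M) (S : ℕ)

omit [∀ μ, NeZero (M' μ)] in
/-- ★ `ρ_{W,π} ∘ M_{χ_□} = ρ_{W,π}`: the restriction to the cube's bonds ignores a source cut by the cube's indicator. [folklore] -/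
theorem restrictOp_comp_mulOp_chiCube : restrictOp (cubeW n c S) (redBond n hM) ∘ₗ mulOp (chiCube M n c S) = restrictOp (cubeW n c S) (redBond n hM) := by
  refine LinearMap.ext fun f => funext fun x' => ?_
  rw [LinearMap.comp_apply, restrictOp_apply, restrictOp_apply]
  refine Finset.sum_congr rfl fun x hx => ?_
  rw [mulOp_apply, chiCube_eq_ite, if_pos (Finset.mem_filter.mp hx).1, one_mul]

/-- ★ `G^{↑}(□) ∘ M_{χ_□} = G^{↑}(□)` (FILE 76's `hNχ` for the lifted cubes). [cite: Balaban1984PropagatorsII, (2.37) p.229, p.238 (T_□)] -/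
theorem liftCubeG_comp_mulOp_chiCube (a : ℝ) : liftCubeG n hM c S a ∘ₗ mulOp (chiCube M n c S) = liftCubeG n hM c S a := by
  unfold liftCubeG
  rw [LinearMap.comp_assoc, LinearMap.comp_assoc, restrictOp_comp_mulOp_chiCube]

end Cut

/-! ## §2 The remainder row's two-grid defect for one lifted cube of the cover on the torus of record -/

section Row

variable {L : ℕ} [NeZero L]

set_option maxHeartbeats 400000 in
/-- ★★★ **THE TWO-GRID η-DEFECT OF THE REMAINDER ROW OF ONE LIFTED CUBE OF THE COVER ON THE TORUS OF RECORD** — FILE 74 with every row inhabited by dag-n15-a's PROGRAMME P, RATE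
`(L^K)^{−1∕16}`, constants free of the volume `m_T`, the cube exponent `s`, the spacings and the cube index; one images-type row displayed (`HY`). [cite: Balaban1984PropagatorsII, (2.92)–(2.93)
p.239, (2.133)–(2.136) p.247 (shapes + mechanism); Balaban1985BackgroundPropagators, Thm 3.14 pp.426–427 (difference template); Balaban1984PropagatorsI, (1.18) p.20, (1.69) p.29, (1.126) p.38] -/
theorem hasMaj_idef_commOp_deltaOp_comp_knitGR (hL : Odd L ∧ 1 < L) {a : ℝ} (ha : 0 < a) {δY mY : ℝ} (hδY : 0 < δY) (hmY : 0 ≤ mY)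
    (HY : ∀ (s mT K r : ℕ) (hs : s + 1 ≤ mT) (_hK : 1 ≤ K) (_hn4 : 4 ≤ L ^ K) (k : Fin (d + 1) → ZMod (2 * L ^ (mT - s))),
      HasMaj (BlockNorm.ofBlocks (unitTorusGeo L K (MP (paramsOf d L mT K hL))) (fun b : Tor (fine (L ^ K) (MP (paramsOf d L mT K hL))) × Fin (d + 1) => blockOf (L ^ K) (MP (paramsOf d L mT K hL)) b.1))
        (BlockNorm.ofBlocks (unitTorusGeo L K (MP (paramsOf d L mT K hL))) (fun i : Tor (fine (L ^ r * L ^ K) (MP (paramsOf d L mT K hL))) × Fin (d + 1) => blockOf (L ^ r * L ^ K) (MP (paramsOf d L mT K hL)) i.1))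
        (idef (pull (kingPrV L K r (MP (paramsOf d L mT K hL)))) (pull (kingPrV L K r (MP (paramsOf d L mT K hL))))
          (mulOp (chiCube (MP (paramsOf d L mT K hL)) (L ^ r * L ^ K) (coverCorner (MP (paramsOf d L mT K hL)) (L ^ s) (L ^ (mT - s)) (coverMargin L s) k) (L ^ (s + 1))) ∘ₗ
            ((a • (qvAdjRe (MP (paramsOf d L mT K hL)) (L ^ r * L ^ K) ∘ₗ qvRe (MP (paramsOf d L mT K hL)) (L ^ r * L ^ K)) + (-landauRe (MP (paramsOf d L mT K hL)) (L ^ r * L ^ K))) ∘ₗ knitGR d L s mT K (L ^ r * L ^ K) hL hs a k))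
          (mulOp (chiCube (MP (paramsOf d L mT K hL)) (L ^ K) (coverCorner (MP (paramsOf d L mT K hL)) (L ^ s) (L ^ (mT - s)) (coverMargin L s) k) (L ^ (s + 1))) ∘ₗ
            ((a • (qvAdjRe (MP (paramsOf d L mT K hL)) (L ^ K) ∘ₗ qvRe (MP (paramsOf d L mT K hL)) (L ^ K)) + (-landauRe (MP (paramsOf d L mT K hL)) (L ^ K))) ∘ₗ knitGR d L s mT K (L ^ K) hL hs a k)))
        (fun y y' => ind ((cubeBlocks (MP (paramsOf d L mT K hL)) (coverCorner (MP (paramsOf d L mT K hL)) (L ^ s) (L ^ (mT - s)) (coverMargin L s) k) (L ^ (s + 1)) : Finset _) : Set _) y * ind ((cubeBlocks (MP (paramsOf d L mT K hL)) (coverCorner (MP (paramsOf d L mT K hL)) (L ^ s) (L ^ (mT - s)) (coverMargin L s) k) (L ^ (s + 1)) : Finset _) : Set _) y' *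
          (mY * ((L ^ K : ℕ) : ℝ) ^ (-(1 / 16 : ℝ)) * Real.exp (-(δY * tdistT (MP (paramsOf d L mT K hL)) y y'))))) :
    ∃ δ Cr : ℝ, 0 < δ ∧ 0 < Cr ∧ ∀ (s mT K r : ℕ) (hs : s + 1 ≤ mT) (_hK : 1 ≤ K) (_hn4 : 4 ≤ L ^ K) (k : Fin (d + 1) → ZMod (2 * L ^ (mT - s))),
      HasMaj (BlockNorm.ofBlocks (unitTorusGeo L K (MP (paramsOf d L mT K hL))) (fun b : Tor (fine (L ^ K) (MP (paramsOf d L mT K hL))) × Fin (d + 1) => blockOf (L ^ K) (MP (paramsOf d L mT K hL)) b.1))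
        (BlockNorm.ofBlocks (unitTorusGeo L K (MP (paramsOf d L mT K hL)))
          (fun i : Tor (fine (L ^ r * L ^ K) (MP (paramsOf d L mT K hL))) × Fin (d + 1) => blockOf (L ^ r * L ^ K) (MP (paramsOf d L mT K hL)) i.1))
        (idef (pull (kingPrV L K r (MP (paramsOf d L mT K hL)))) (pull (kingPrV L K r (MP (paramsOf d L mT K hL))))
          (commOp (deltaOp (MP (paramsOf d L mT K hL)) (L ^ r * L ^ K) a) (knitHR d L s mT K (L ^ r * L ^ K) hL k) ∘ₗ knitGR d L s mT K (L ^ r * L ^ K) hL hs a k)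
          (commOp (deltaOp (MP (paramsOf d L mT K hL)) (L ^ K) a) (knitHR d L s mT K (L ^ K) hL k) ∘ₗ knitGR d L s mT K (L ^ K) hL hs a k))
        (fun y y' => ind ((cubeBlocks (MP (paramsOf d L mT K hL)) (coverCorner (MP (paramsOf d L mT K hL)) (L ^ s) (L ^ (mT - s)) (coverMargin L s) k) (L ^ (s + 1)) : Finset _) : Set _) y' *
          (Cr * ((L ^ K : ℕ) : ℝ) ^ (-(1 / 16 : ℝ)) * Real.exp (-(δ * tdistT (MP (paramsOf d L mT K hL)) y y')))) := by
  have hLodd : Odd L := hL.1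
  have hL2 : 2 ≤ L := hL.2
  have hL3 : 3 ≤ L := by obtain ⟨⟨j, hj⟩, h1⟩ := hL; omega
  have hLpos : 0 < L := by omega
  -- the letters (all uniform in the volume)
  obtain ⟨δG, βG, hδG, hβG, HG⟩ := hasMaj_chiCube_liftCubeG (d := d) hL ha
  obtain ⟨δD, βD, hδD, hβD, HD⟩ := hasMaj_chiCube_grad_liftCubeG (d := d) hL ha
  obtain ⟨δB, βB, hδB, hβB, HB⟩ := hasMaj_chiCube_divAdjOut_liftCubeG_pair (d := d) hL ha
  obtain ⟨δ₀, C, hδ₀, hC, HP⟩ := hasMaj_chiCube_comp_liftCubeG_family (d := d) hL ha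
  obtain ⟨δ₁, C₁, hδ₁, hC₁, HL⟩ := hasMaj_landauRe (d := d) (L := L)
  obtain ⟨δc, mc, hδc, hmc, HC⟩ := hasMaj_idef_chiCube_liftCubeG (d := d) hLodd hL2 ha (γ := 1 / 8) (by norm_num) (by norm_num)
  obtain ⟨δe, me, hδe, hme, HE⟩ := hasMaj_idef_chiCube_grad_liftCubeG (d := d) hLodd hL2 ha
  obtain ⟨δh, mh, hδh, hmh, HH⟩ := hasMaj_idef_chiCube_divAdjOut_liftCubeG (d := d) hLodd hL2 ha
  obtain ⟨δV, CV, hδV, hCV, HV⟩ := hasMaj_landauDefect_family (d := d) hLodd hL2 ha (γ := 1 / 8) (by norm_num) (by norm_num)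
  set δm : ℝ := min (min (min (min δG δD) (min δB δ₀)) (min (min δ₁ δc) (min δe δh))) (min δV δY) with hδm_def
  have hδm : 0 < δm := lt_min (lt_min (lt_min (lt_min hδG hδD) (lt_min hδB hδ₀)) (lt_min (lt_min hδ₁ hδc) (lt_min hδe hδh))) (lt_min hδV hδY)
  have hA : δm ≤ min (min (min δG δD) (min δB δ₀)) (min (min δ₁ δc) (min δe δh)) := min_le_left _ _
  have hmG : δm ≤ δG := hA.trans ((min_le_left _ _).trans ((min_le_left _ _).trans (min_le_left _ _)))
  have hmD : δm ≤ δD := hA.trans ((min_le_left _ _).trans ((min_le_left _ _).trans (min_le_right _ _)))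
  have hmB : δm ≤ δB := hA.trans ((min_le_left _ _).trans ((min_le_right _ _).trans (min_le_left _ _)))
  have hm0 : δm ≤ δ₀ := hA.trans ((min_le_left _ _).trans ((min_le_right _ _).trans (min_le_right _ _)))
  have hm1 : δm ≤ δ₁ := hA.trans ((min_le_right _ _).trans ((min_le_left _ _).trans (min_le_left _ _)))
  have hmc' : δm ≤ δc := hA.trans ((min_le_right _ _).trans ((min_le_left _ _).trans (min_le_right _ _)))
  have hme' : δm ≤ δe := hA.trans ((min_le_right _ _).trans ((min_le_right _ _).trans (min_le_left _ _)))
  have hmh' : δm ≤ δh := hA.trans ((min_le_right _ _).trans ((min_le_right _ _).trans (min_le_right _ _)))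
  have hmV : δm ≤ δV := (min_le_right _ _).trans (min_le_left _ _)
  have hmY : δm ≤ δY := (min_le_right _ _).trans (min_le_right _ _)
  set cr : ℝ := B4Sect5Proof.latticeConst (d + 1) (δm / 4) with hcr_def
  have hcr : 0 ≤ cr := B4Sect5Proof.latticeConst_nonneg (d + 1) (by positivity)
  set β₁ : ℝ := max βD βB with hβ₁_def
  have hβ₁ : 0 ≤ β₁ := hβD.le.trans (le_max_left _ _)
  set cN : ℝ := |a| * (Real.exp δm * Real.exp δm) + C₁ with hcN_def
  have hcN : 0 ≤ cN := by positivity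
  set θ : ℝ := 2 ^ (d + 1) * (cN * (C * Real.exp δ₀) * cr) with hθ_def
  set RB : ℝ := |a| * (Real.exp (δm / 4) * Real.exp (δm / 4) * (1 * β₁ + π * βG) + 2 * Real.exp (δm / 4) * (βG * Real.exp (δm / 4))) + CV * βG * cr with hRB_def
  set R3 : ℝ := 1 * mY + π * (d + 1) * θ with hR3_def
  set Cr : ℝ := ((d + 1 : ℕ) * (32 * π ^ 2 * mc + (144 * π ^ 3 + 32 * π ^ 3 * (d + 1 : ℕ)) * βG + 2 * (π * max me mh + (64 * π ^ 2 + π ^ 2 * (d + 1 : ℕ)) * β₁)) +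
    (cN * (mc + π * (d + 1) * βG) * cr + RB) + R3) + 1 with hCr_def
  have hmax : 0 ≤ max me mh := hme.le.trans (le_max_left _ _)
  refine ⟨δm / 4, Cr, by positivity, by positivity, fun s mT K r hs hK hn4 k => ?_⟩
  -- the index's data
  set M : Fin (d + 1) → ℕ := MP (paramsOf d L mT K hL) with hMdef
  have hs' : s ≤ mT := by omega
  have hM : ∀ ν, M ν = 2 * L ^ (mT - s) * L ^ s := MP_eq_two_mul L s mT K hL hs'
  have hw : 0 < L ^ s := pow_pos hLpos s
  have hn : 1 ≤ L ^ K := Nat.one_le_pow _ _ hLpos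
  haveI : NeZero (L ^ (mT - s)) := ⟨pow_ne_zero _ (NeZero.ne L)⟩
  have hSe : L ^ (s + 1) = L * L ^ s := by rw [pow_succ, mul_comm]
  have hfit : 2 * coverMargin L s + 2 * L ^ s + 1 ≤ L ^ (s + 1) := by rw [hSe]; exact coverMargin_fit hL3 s
  have hfit1 : coverMargin L s + 2 * L ^ s + 1 ≤ L ^ (s + 1) := by omega
  have hS : L ^ (s + 1) ≤ 2 * L ^ (mT - s) * L ^ s := by
    rw [← hM 0]
    show L ^ (s + 1) ≤ 2 * L ^ mT
    have := Nat.pow_le_pow_right hLpos hs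
    omega
  have h3 : 3 ≤ L ^ K * L ^ s :=
    calc 3 ≤ L := hL3
      _ = L ^ 1 := (pow_one L).symm
      _ ≤ L ^ K := Nat.pow_le_pow_right hLpos hK
      _ = L ^ K * 1 := (mul_one _).symm
      _ ≤ L ^ K * L ^ s := Nat.mul_le_mul_left _ hw
  have hwR : (1 : ℝ) ≤ ((L ^ s : ℕ) : ℝ) := by exact_mod_cast hw
  have hnR : (1 : ℝ) ≤ ((L ^ K : ℕ) : ℝ) := by exact_mod_cast hn
  have hnR0 : (0 : ℝ) < ((L ^ K : ℕ) : ℝ) := by linarith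
  set ε : ℝ := ((L ^ K : ℕ) : ℝ) ^ (-(1 / 16 : ℝ)) with hε_def
  obtain ⟨hnε, hnwε, hw1, hε0⟩ := rpow_sixteenth_facts hnR hwR
  have hexp16 : (-((1 : ℝ) / 8 / 2)) = -(1 / 16 : ℝ) := by norm_num
  set c : Tor M := coverCorner M (L ^ s) (L ^ (mT - s)) (coverMargin L s) k with hc_def
  have hrow := rowSum_unitTorusGeo (L := L) (k := K) (M := M) (σ := δm / 4) (by positivity)
  have hblk : (fun i : Tor (fine (L ^ r * L ^ K) M) × Fin (d + 1) => blockOf (L ^ r * L ^ K) M i.1) =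
      (fun b : Tor (fine (L ^ K) M) × Fin (d + 1) => blockOf (L ^ K) M b.1) ∘ kingPrV L K r M := (VectorPiece.blkFine_comp_kingPrV (M := M) L K r).symm
  have hblk' : (fun i : Tor (fine (L ^ r * L ^ K) (MP (paramsOf d L mT K hL))) × Fin (d + 1) => blockOf (L ^ r * L ^ K) (MP (paramsOf d L mT K hL)) i.1) =
      (fun b : Tor (fine (L ^ K) M) × Fin (d + 1) => blockOf (L ^ K) M b.1) ∘ kingPrV L K r M := hblk
  have hind : ∀ y y' : Tor M, 0 ≤ ind (g := unitTorusGeo L K M) ((cubeBlocks M c (L ^ (s + 1)) : Finset (Tor M)) : Set (Tor M)) y *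
      ind (g := unitTorusGeo L K M) ((cubeBlocks M c (L ^ (s + 1)) : Finset (Tor M)) : Set (Tor M)) y' := fun y y' => mul_nonneg (ind_nonneg _ _) (ind_nonneg _ _)
  -- nonlocal letters at both spacings
  have hNLc := hasMaj_nonlocalPart (L := L) (kk := K) (M := M) (n := L ^ K) (a := a) hC₁.le hδm.le hm1 (HL K (L ^ K) M)
  have hNL' := hasMaj_nonlocalPart (L := L) (kk := K) (M := M) (n := L ^ r * L ^ K) (a := a) hC₁.le hδm.le hm1 (HL K (L ^ r * L ^ K) M)
  -- coarse cut rows (P-IIb, P-IId), weakened to `δm ∕ 2`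
  have hGc0 : HasMaj (BlockNorm.ofBlocks (unitTorusGeo L K M) (fun b : Tor (fine (L ^ K) M) × Fin (d + 1) => blockOf (L ^ K) M b.1))
      (BlockNorm.ofBlocks (unitTorusGeo L K M) (fun b : Tor (fine (L ^ K) M) × Fin (d + 1) => blockOf (L ^ K) M b.1))
      (mulOp (chiCube M (L ^ K) c (L ^ (s + 1))) ∘ₗ knitGR d L s mT K (L ^ K) hL hs a k)
      (fun y y' => ind ((cubeBlocks M c (L ^ (s + 1)) : Finset (Tor M)) : Set (Tor M)) y * ind ((cubeBlocks M c (L ^ (s + 1)) : Finset (Tor M)) : Set (Tor M)) y' *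
        (βG * Real.exp (-(δG * tdistT M y y')))) := HG (s + 1) mT K hs hK c
  have hGc := hasMaj_rate_le (hind) hβG.le (by linarith : δm / 2 ≤ δG) hGc0
  have hDc0 : ∀ μ, HasMaj (BlockNorm.ofBlocks (unitTorusGeo L K M) (fun b : Tor (fine (L ^ K) M) × Fin (d + 1) => blockOf (L ^ K) M b.1))
      (BlockNorm.ofBlocks (unitTorusGeo L K M) (fun b : Tor (fine (L ^ K) M) × Fin (d + 1) => blockOf (L ^ K) M b.1))
      (mulOp (chiCube M (L ^ K) c (L ^ (s + 1))) ∘ₗ (fgrad ((L ^ K : ℕ) : ℝ) (bshiftEquiv M (L ^ K) μ) ∘ₗ knitGR d L s mT K (L ^ K) hL hs a k))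
      (fun y y' => ind ((cubeBlocks M c (L ^ (s + 1)) : Finset (Tor M)) : Set (Tor M)) y * ind ((cubeBlocks M c (L ^ (s + 1)) : Finset (Tor M)) : Set (Tor M)) y' *
        (βD * Real.exp (-(δD * tdistT M y y')))) := fun μ => by
    rw [← symbOp_sD_eq]
    exact HD (s + 1) mT K hs hK c μ
  have hDc : ∀ μ, HasMaj (BlockNorm.ofBlocks (unitTorusGeo L K M) (fun b : Tor (fine (L ^ K) M) × Fin (d + 1) => blockOf (L ^ K) M b.1))
      (BlockNorm.ofBlocks (unitTorusGeo L K M) (fun b : Tor (fine (L ^ K) M) × Fin (d + 1) => blockOf (L ^ K) M b.1))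
      (mulOp (chiCube M (L ^ K) c (L ^ (s + 1))) ∘ₗ (fgrad ((L ^ K : ℕ) : ℝ) (bshiftEquiv M (L ^ K) μ) ∘ₗ knitGR d L s mT K (L ^ K) hL hs a k))
      (fun y y' => ind ((cubeBlocks M c (L ^ (s + 1)) : Finset (Tor M)) : Set (Tor M)) y * ind ((cubeBlocks M c (L ^ (s + 1)) : Finset (Tor M)) : Set (Tor M)) y' *
        (β₁ * Real.exp (-(δm / 2 * tdistT M y y')))) := fun μ =>
    (hasMaj_rate_le (hind) hβD.le (by linarith : δm / 2 ≤ δD) (hDc0 μ)).mono fun y y' =>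
      mul_le_mul_of_nonneg_left (mul_le_mul_of_nonneg_right (le_max_left _ _) (Real.exp_nonneg _)) (hind y y')
  have hDbc : ∀ μ, HasMaj (BlockNorm.ofBlocks (unitTorusGeo L K M) (fun b : Tor (fine (L ^ K) M) × Fin (d + 1) => blockOf (L ^ K) M b.1))
      (BlockNorm.ofBlocks (unitTorusGeo L K M) (fun b : Tor (fine (L ^ K) M) × Fin (d + 1) => blockOf (L ^ K) M b.1))
      (mulOp (chiCube M (L ^ K) c (L ^ (s + 1))) ∘ₗ (bgrad ((L ^ K : ℕ) : ℝ) (bshiftEquiv M (L ^ K) μ) ∘ₗ knitGR d L s mT K (L ^ K) hL hs a k))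
      (fun y y' => ind ((cubeBlocks M c (L ^ (s + 1)) : Finset (Tor M)) : Set (Tor M)) y * ind ((cubeBlocks M c (L ^ (s + 1)) : Finset (Tor M)) : Set (Tor M)) y' *
        (β₁ * Real.exp (-(δm / 2 * tdistT M y y')))) := fun μ => by
    rw [bgrad_eq_neg_symbOp, LinearMap.neg_comp, LinearMap.comp_neg]
    exact ((hasMaj_rate_le (hind) hβB.le (by linarith : δm / 2 ≤ δB) ((HB (s + 1) mT K r hs hK c μ).1)).mono fun y y' =>
      mul_le_mul_of_nonneg_left (mul_le_mul_of_nonneg_right (le_max_right _ _) (Real.exp_nonneg _)) (hind y y')).neg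
  -- cut defects (P-IIc, P-IId), weakened to `δm ∕ 2`
  have hIGc0 := HC (s + 1) mT K r hK hL hs c
  rw [hexp16] at hIGc0
  have hIGc : HasMaj (BlockNorm.ofBlocks (unitTorusGeo L K M) (fun b : Tor (fine (L ^ K) M) × Fin (d + 1) => blockOf (L ^ K) M b.1))
      (BlockNorm.ofBlocks (unitTorusGeo L K M) (fun i : Tor (fine (L ^ r * L ^ K) M) × Fin (d + 1) => blockOf (L ^ r * L ^ K) M i.1))
      (idef (pull (kingPrV L K r M)) (pull (kingPrV L K r M))
        (mulOp (chiCube M (L ^ r * L ^ K) c (L ^ (s + 1))) ∘ₗ knitGR d L s mT K (L ^ r * L ^ K) hL hs a k)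
        (mulOp (chiCube M (L ^ K) c (L ^ (s + 1))) ∘ₗ knitGR d L s mT K (L ^ K) hL hs a k))
      (fun y y' => ind ((cubeBlocks M c (L ^ (s + 1)) : Finset (Tor M)) : Set (Tor M)) y * ind ((cubeBlocks M c (L ^ (s + 1)) : Finset (Tor M)) : Set (Tor M)) y' *
        (mc * ε * Real.exp (-(δm / 2 * tdistT M y y')))) :=
    hasMaj_rate_le (hind) (by positivity : 0 ≤ mc * ε) (by linarith : δm / 2 ≤ δc) hIGc0
  have hIDc : ∀ μ, HasMaj (BlockNorm.ofBlocks (unitTorusGeo L K M) (fun b : Tor (fine (L ^ K) M) × Fin (d + 1) => blockOf (L ^ K) M b.1))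
      (BlockNorm.ofBlocks (unitTorusGeo L K M) (fun i : Tor (fine (L ^ r * L ^ K) M) × Fin (d + 1) => blockOf (L ^ r * L ^ K) M i.1))
      (idef (pull (kingPrV L K r M)) (pull (kingPrV L K r M))
        (mulOp (chiCube M (L ^ r * L ^ K) c (L ^ (s + 1))) ∘ₗ (fgrad ((L ^ r * L ^ K : ℕ) : ℝ) (bshiftEquiv M (L ^ r * L ^ K) μ) ∘ₗ knitGR d L s mT K (L ^ r * L ^ K) hL hs a k))
        (mulOp (chiCube M (L ^ K) c (L ^ (s + 1))) ∘ₗ (fgrad ((L ^ K : ℕ) : ℝ) (bshiftEquiv M (L ^ K) μ) ∘ₗ knitGR d L s mT K (L ^ K) hL hs a k)))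
      (fun y y' => ind ((cubeBlocks M c (L ^ (s + 1)) : Finset (Tor M)) : Set (Tor M)) y * ind ((cubeBlocks M c (L ^ (s + 1)) : Finset (Tor M)) : Set (Tor M)) y' *
        (max me mh * ε * Real.exp (-(δm / 2 * tdistT M y y')))) := fun μ => by
    have h := HE (s + 1) mT K r hK hn4 hL hs c μ
    rw [symbOp_sD_eq, symbOp_sD_eq] at h
    exact (hasMaj_rate_le (hind) (by positivity : 0 ≤ me * ε) (by linarith : δm / 2 ≤ δe) h).mono fun y y' =>
      mul_le_mul_of_nonneg_left (mul_le_mul_of_nonneg_right (mul_le_mul_of_nonneg_right (le_max_left _ _) hε0) (Real.exp_nonneg _)) (hind y y')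
  have hIDbc : ∀ μ, HasMaj (BlockNorm.ofBlocks (unitTorusGeo L K M) (fun b : Tor (fine (L ^ K) M) × Fin (d + 1) => blockOf (L ^ K) M b.1))
      (BlockNorm.ofBlocks (unitTorusGeo L K M) (fun i : Tor (fine (L ^ r * L ^ K) M) × Fin (d + 1) => blockOf (L ^ r * L ^ K) M i.1))
      (idef (pull (kingPrV L K r M)) (pull (kingPrV L K r M))
        (mulOp (chiCube M (L ^ r * L ^ K) c (L ^ (s + 1))) ∘ₗ (bgrad ((L ^ r * L ^ K : ℕ) : ℝ) (bshiftEquiv M (L ^ r * L ^ K) μ) ∘ₗ knitGR d L s mT K (L ^ r * L ^ K) hL hs a k))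
        (mulOp (chiCube M (L ^ K) c (L ^ (s + 1))) ∘ₗ (bgrad ((L ^ K : ℕ) : ℝ) (bshiftEquiv M (L ^ K) μ) ∘ₗ knitGR d L s mT K (L ^ K) hL hs a k)))
      (fun y y' => ind ((cubeBlocks M c (L ^ (s + 1)) : Finset (Tor M)) : Set (Tor M)) y * ind ((cubeBlocks M c (L ^ (s + 1)) : Finset (Tor M)) : Set (Tor M)) y' *
        (max me mh * ε * Real.exp (-(δm / 2 * tdistT M y y')))) := fun μ => by
    have h := HH (s + 1) mT K r hK hn4 hL hs c μ
    rw [bgrad_eq_neg_symbOp, bgrad_eq_neg_symbOp, LinearMap.neg_comp, LinearMap.comp_neg, LinearMap.neg_comp, LinearMap.comp_neg, idef_neg]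
    exact ((hasMaj_rate_le (hind) (by positivity : 0 ≤ mh * ε) (by linarith : δm / 2 ≤ δh) h).mono fun y y' =>
      mul_le_mul_of_nonneg_left (mul_le_mul_of_nonneg_right (mul_le_mul_of_nonneg_right (le_max_right _ _) hε0) (Real.exp_nonneg _)) (hind y y')).neg
  -- the partition: cuts, bound, fit
  have hχ := chiCube_coverCorner_eq_one_side (M := M) (n := L ^ K) (m₀ := coverMargin L s) hM hw hfit1 hS 0 k
  have hχ' := chiCube_coverCorner_eq_one_side (M := M) (n := L ^ r * L ^ K) (m₀ := coverMargin L s) hM hw hfit1 hS 0 k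
  have hcut := hcube_cut (2 * L ^ (mT - s)) (coverXi M (L ^ K) (L ^ s)) (bshiftEquiv M (L ^ K)) 0 hχ
  have hcut' := hcube_cut (2 * L ^ (mT - s)) (coverXi M (L ^ r * L ^ K) (L ^ s)) (bshiftEquiv M (L ^ r * L ^ K)) 0 hχ'
  have hh : ∀ x, |knitHR d L s mT K (L ^ K) hL k x| ≤ 1 := fun x => abs_coverH_le_one k x
  have hh' : ∀ x', |knitHR d L s mT K (L ^ r * L ^ K) hL k x'| ≤ 1 := fun x' => abs_coverH_le_one k x'
  have hfitH : ∀ x', |knitHR d L s mT K (L ^ r * L ^ K) hL k x' - knitHR d L s mT K (L ^ K) hL k (kingPrV L K r M x')| ≤ π * (d + 1) / (((L ^ K : ℕ) : ℝ) * ((L ^ s : ℕ) : ℝ)) :=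
    fun x' => abs_coverH_fine_sub_le (L := L) (kk := K) (r := r) hM hw k x'
  -- `r₃`: (β′) behind the cut + the displayed images-type row
  have hY := HP (s + 1) mT K hs hK c (a • (qvAdjRe M (L ^ K) ∘ₗ qvRe M (L ^ K)) + (-landauRe M (L ^ K))) hrow hcN (by positivity : 0 ≤ δm / 2)
    (by linarith : δm / 2 ≤ δ₀) (by linarith : δm / 2 + δm / 4 ≤ δm) hNLc
  have hIY0 := HY s mT K r hs hK hn4 k
  have hIY := hasMaj_rate_le (hind) (by positivity : 0 ≤ mY * ε) (by linarith : δm / 2 ≤ δY) hIY0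
  rw [hblk] at hIY
  have hD3 := hasMaj_idef_mulOp_nonlocal_of_cut (g := unitTorusGeo L K M) (fun b : Tor (fine (L ^ K) M) × Fin (d + 1) => blockOf (L ^ K) M b.1) (kingPrV L K r M)
    (by positivity : (0 : ℝ) ≤ π * (d + 1) / (((L ^ K : ℕ) : ℝ) * ((L ^ s : ℕ) : ℝ))) hcut hcut' hh' hfitH hY hIY
  rw [← hblk] at hD3
  -- `r_B`: the Landau operator defect and the block-averaging composite
  have hV0 := HV mT K r hK hL
  rw [hexp16, hblk'] at hV0
  have hNχ : knitGR d L s mT K (L ^ K) hL hs a k ∘ₗ mulOp (chiCube M (L ^ K) c (L ^ (s + 1))) = knitGR d L s mT K (L ^ K) hL hs a k :=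
    liftCubeG_comp_mulOp_chiCube (L ^ K) (MP_dvd_MP hL hs K) c (L ^ (s + 1)) a
  have hQ := hasMaj_idef_qq_comp_cover (L := L) (kk := K) (r := r) (M := M) hM hw hfit1 hS k hβG.le hβD.le (by positivity : 0 ≤ δm / 4)
    (by linarith [le_min hmG hmD, hδm] : δm / 4 ≤ min δG δD) hNχ (hasMaj_rate_le (hind) hβG.le (min_le_left δG δD) hGc0)
    (fun μ => hasMaj_rate_le (hind) hβD.le (min_le_right δG δD) (hDc0 μ))
  rw [hblk] at hQ
  have hT3 := hasMaj_idef_nonlocalPart_comp (g := unitTorusGeo L K M) (fun b : Tor (fine (L ^ K) M) × Fin (d + 1) => blockOf (L ^ K) M b.1) (kingPrV L K r M)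
    (triangle254_unitTorusGeo L K M) (unitTorusGeo_dist_nonneg L K M) hrow (a := a)
    (by positivity : 0 ≤ Real.exp (δm / 4) * Real.exp (δm / 4) * ((((L ^ K : ℕ) : ℝ))⁻¹ * (1 * βD + π / ((L ^ s : ℕ) : ℝ) * βG)) +
      2 * Real.exp (δm / 4) / (L : ℝ) ^ K * (βG * Real.exp (δm / 4)))
    (by positivity : 0 ≤ CV * ε) hβG.le (by positivity : 0 ≤ δm / 4) (by linarith : δm / 4 ≤ δm / 2) (by linarith : δm / 4 + δm / 4 ≤ δV) hh hGc hV0 hQ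
  rw [← hblk] at hT3
  -- FILE 74
  rw [deltaOp_eq_lapOp_zero_add (M := M) (n := L ^ r * L ^ K) a, deltaOp_eq_lapOp_zero_add (M := M) (n := L ^ K) a]
  have key := hasMaj_idef_commOp_comp_cover_of (L := L) (kk := K) (r := r) (M := M) (q := L ^ (mT - s)) (w := L ^ s) (m₀ := coverMargin L s) (S := L ^ (s + 1))
    (N := knitGR d L s mT K (L ^ K) hL hs a k) (N' := knitGR d L s mT K (L ^ r * L ^ K) hL hs a k)
    (NL := a • (qvAdjRe M (L ^ K) ∘ₗ qvRe M (L ^ K)) + (-landauRe M (L ^ K))) (NL' := a • (qvAdjRe M (L ^ r * L ^ K) ∘ₗ qvRe M (L ^ r * L ^ K)) + (-landauRe M (L ^ r * L ^ K)))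
    hM hw hfit hS h3 k hβG.le hβ₁ (by positivity : 0 ≤ mc * ε)
    (by positivity : 0 ≤ max me mh * ε) hcN (by positivity) (by positivity : 0 ≤ δm / 4) (by linarith : δm / 4 ≤ δm / 2) (by linarith : δm / 4 + δm / 4 ≤ δm) hrow
    hGc hDc hDbc hIGc hIDc hIDbc hNL' hT3 hD3
  refine key.mono fun y y' => mul_le_mul_of_nonneg_left (mul_le_mul_of_nonneg_right ?_ (Real.exp_nonneg _)) (ind_nonneg _ _)
  clear key hT3 hD3 hQ hV0 hIY hIY0 hY hNχ hIDbc hIDc hIGc hIGc0 hDbc hDc hDc0 hGc hGc0 hNL' hNLc hfitH hh hh' hcut hcut' hχ hχ' HY HC HE HH HV HG HD HB HP HL hrow hblk' hblk hind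
  -- the compression (the block-averaging constant uses `βD ≤ β₁`)
  have hLk : 2 * Real.exp (δm / 4) / (L : ℝ) ^ K * (βG * Real.exp (δm / 4)) = 2 * Real.exp (δm / 4) * (((L ^ K : ℕ) : ℝ))⁻¹ * (βG * Real.exp (δm / 4)) := by
    rw [div_eq_mul_inv]; push_cast; ring
  rw [hLk]
  have hrB0 := rB_le_of (a := a) (CV := CV) (cr := cr) hnε hε0 hwR (Real.exp_nonneg (δm / 4)) hβG.le hβD.le
  have hrB : |a| * (Real.exp (δm / 4) * Real.exp (δm / 4) * ((((L ^ K : ℕ) : ℝ))⁻¹ * (1 * βD + π / ((L ^ s : ℕ) : ℝ) * βG)) +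
      2 * Real.exp (δm / 4) * (((L ^ K : ℕ) : ℝ))⁻¹ * (βG * Real.exp (δm / 4))) + CV * ε * βG * cr ≤ RB * ε := by
    refine hrB0.trans ?_
    rw [hRB_def]
    have hD1 : 1 * βD ≤ 1 * β₁ := by rw [one_mul, one_mul]; exact le_max_left _ _
    have t : Real.exp (δm / 4) * Real.exp (δm / 4) * (1 * βD + π * βG) ≤ Real.exp (δm / 4) * Real.exp (δm / 4) * (1 * β₁ + π * βG) :=
      mul_le_mul_of_nonneg_left (by linarith) (by positivity)
    have t2 := mul_le_mul_of_nonneg_left (add_le_add t (le_refl (2 * Real.exp (δm / 4) * (βG * Real.exp (δm / 4))))) (abs_nonneg a)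
    exact mul_le_mul_of_nonneg_right (add_le_add t2 le_rfl) hε0
  have ho : π * (d + 1) / (((L ^ K : ℕ) : ℝ) * ((L ^ s : ℕ) : ℝ)) ≤ π * (d + 1) * ε := by
    rw [div_eq_mul_inv]; exact mul_le_mul_of_nonneg_left hnwε (by positivity)
  have hr₃ := r3_le_of (mY := mY) ho (by positivity : (0 : ℝ) ≤ 2 ^ (d + 1) * (cN * (C * Real.exp δ₀) * cr))
  have hcomp := remainderDefectConst_le d (mc := mc) (mm := max me mh) (RB := RB) (R3 := R3) hwR hnR0 hnwε hβG.le hβ₁ hcN hcr (le_refl (mc * ε)) (by positivity)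
    (le_refl (max me mh * ε)) (by positivity) hrB hr₃
  refine hcomp.trans ?_
  rw [hCr_def, add_mul _ (1 : ℝ) ε, one_mul]
  exact le_add_of_nonneg_right hε0

end Row

end Summit.QuantumFields.YangMills.BalabanUVNodes.N15.Gluing

end
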